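import Summits.CriticalPhenomena.CardyFormulaZ2.Theorems.CardyIKTransportIKMixedBoxCrossingDefectGlueDefs

/-!
# Line `defect-closure-exploration`, reshape v3b (lead c2) — the `∀ S` layer as a junction across the anchor COLUMN:
# VOCABULARY + COMPOSITION for the crux `IKMixedBoxCrossing` (stmt-CriticalPhenomena-5911)

Definitions-only support file, companion of `…DefectGlueDefs.lean` (p116391/p116548). Nothing is asserted: every
`def … : Prop` is a statement the LINE POSITS (registered stub or glue), never a literature fact.

`RowFactorisation` / `RowGluing` hold for every pattern `S` (landed p120247 / p120889), so the VERTICAL clause of the crux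
for every `S` is the row inequality `ContactSecondMomentRow` (uniform in `S`).  The HORIZONTAL clause is its transpose
across the anchor column `x = 0` of the gauge (where, as on the anchor row, the window cells read no plaquette): right
half-box `Rt = [1, h] × [b, b+k)`, left half-box `Lf = [-h, -1] × [b, b+k)`, window = column `0`; the column Markov
property holds for every `S` (across a honeycomb face column it is exact independence, `indepFun_curtain`).  Net
(`mixed_of`, sorry-free): `MixedBoxCrossingFree` — hence the crux for EVERY pattern, by `GaugeBridge` (landed p118175 +
p119385) and `Negative.iff_named` — follows from the landed row junction, the column junction (`ColFactorisation`,
`ColGluing`: provable now, transposes of the landed files) and TWO contact-second-moment inequalities uniform in `S`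
(`ContactSecondMomentRow`, `ContactSecondMomentCol`: the open analytic residue of the whole crux) — no transport, no
isotropy floor, no squares, no association.
-/

noncomputable section

namespace Summit.CriticalPhenomena.CardyFormulaZ2.Cruxes.IKMixedBoxCrossing.DefectClosureExploration

open scoped BigOperators Classical ENNReal NNReal
open MeasureTheory Finset
open Literature.Probability.Percolation Literature.Probability.LatticeModels
open Summit.CriticalPhenomena.CardyFormulaZ2.Theorems.IKLinearTransport.PinnedDiagramExchange
  (Ω μIK blackSet antiSet Obs obs νmix blackEdges lrCross tbCross determinedOn)
open Summit.CriticalPhenomena.CardyFormulaZ2.Theorems.IKLinearTransport.PinnedDiagramExchange.CouplingToLimits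
  (measurable_obs measurable_blackEdges)
open Summit.CriticalPhenomena.CardyFormulaZ2.Cruxes.IKMixedBoxCrossing.PairedMirrorExploration
  (pLR pTB PatternLocality Monotone' pLR_two_mul_eq_pH pTB_two_mul_eq_pV)
open Summit.CriticalPhenomena.CardyFormulaZ2.Theorems.IKMixedBoxCrossing

/-! ## §1 Geometry of the cut along the anchor cell column `0` -/

/-- Cylinder of the axis-column window: the colours of the `k` cells `(0, b+j)`, `j < k`, are `ζ`. -/
def colCyl (b : ℤ) (k : ℕ) (ζ : Fin k → Bool) : Set Obs :=
  {x | ∀ j : Fin k, ((![0, b + j] : Site 2) ∈ x.1 ↔ ζ j = true)}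

/-- Right half-box `Rt = [1, h] × [b, b+k)`. -/
def rtBox (b : ℤ) (k h : ℕ) : Set (Site 2) := {v | 1 ≤ v 0 ∧ v 0 ≤ h ∧ b ≤ v 1 ∧ v 1 < b + k}

/-- Left half-box `Lf = [-h, -1] × [b, b+k)`. -/
def lfBox (b : ℤ) (k h : ℕ) : Set (Site 2) := {v | -(h : ℤ) ≤ v 0 ∧ v 0 ≤ -1 ∧ b ≤ v 1 ∧ v 1 < b + k}

/-- Right column of `Rt`. -/
def rtCol (b : ℤ) (k h : ℕ) : Set (Site 2) := {v | v 0 = h ∧ b ≤ v 1 ∧ v 1 < b + k}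

/-- Left column of `Lf`. -/
def lfCol (b : ℤ) (k h : ℕ) : Set (Site 2) := {v | v 0 = -(h : ℤ) ∧ b ≤ v 1 ∧ v 1 < b + k}

/-- RIGHT BOUNDARY ARM at row `j`: the cell `(1, b+j)` is black and joined to the right column of `Rt` by a black path
inside `Rt`. -/
def rtArm (b : ℤ) (k h : ℕ) (j : Fin k) : Set Obs :=
  {x | (![1, b + j] : Site 2) ∈ x.1 ∧ blackEdges x ∈ openCrossing (rtBox b k h) {![1, b + j]} (rtCol b k h)}

/-- LEFT BOUNDARY ARM at row `j`: the cell `(-1, b+j)` is black and joined to the left column of `Lf` by a black path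
inside `Lf`. -/
def lfArm (b : ℤ) (k h : ℕ) (j : Fin k) : Set Obs :=
  {x | (![-1, b + j] : Site 2) ∈ x.1 ∧ blackEdges x ∈ openCrossing (lfBox b k h) {![-1, b + j]} (lfCol b k h)}

/-! ## §2 Column-conditioned contact moments -/

/-- FIRST column-glue moment `Σ_j Σ_{ζ : ζ_j = 1} 2^k ν(rtArm_j ∩ C_ζ) ν(lfArm_j ∩ C_ζ)`. -/
def glueFirstCol (S : Set ℤ) (b : ℤ) (k h : ℕ) : ℝ :=
  ∑ j : Fin k, ∑ ζ : Fin k → Bool,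
    if ζ j = true then
      (2 : ℝ) ^ k * (νmix S).real (rtArm b k h j ∩ colCyl b k ζ) * (νmix S).real (lfArm b k h j ∩ colCyl b k ζ)
    else 0

/-- SECOND column-glue moment. -/
def glueSecondCol (S : Set ℤ) (b : ℤ) (k h : ℕ) : ℝ :=
  ∑ i : Fin k, ∑ j : Fin k, ∑ ζ : Fin k → Bool,
    if ζ i = true ∧ ζ j = true then
      (2 : ℝ) ^ k * (νmix S).real (rtArm b k h i ∩ rtArm b k h j ∩ colCyl b k ζ) *
        (νmix S).real (lfArm b k h i ∩ lfArm b k h j ∩ colCyl b k ζ)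
    else 0

/-! ## §3 Stub statements -/

/-- COLUMN FACTORISATION (exact Markov property across the anchor cell column `0`, finite cylinder form, EVERY `S`):
`ν(A ∩ B ∩ C_ζ) = 2^k ν(A ∩ C_ζ) ν(B ∩ C_ζ)` for `A` read on `Rt`, `B` read on `Lf`. (Transpose of `RowFactorisation`'s
bookkeeping: window cells `(0, y)` are black iff `A 0 ⊕ B y`; on `C_ζ ∩ {A 0 = α}` the right colours read `A x, x ≥ 1`, the
face columns `≥ 0`, the coins of `Rt`; the left colours read `A x, x ≤ -1`, the face columns `≤ -1`, the coins of `Lf`;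
flipping `A x, x ≠ 0` removes `α`.) Size M.
  A statement to be proved (registered stub), not asserted here. -/
def ColFactorisation : Prop :=
  ∀ (S : Set ℤ) (b : ℤ) (k h : ℕ) (A B : Set Obs), MeasurableSet A → MeasurableSet B →
    A ∈ determinedOn (rtBox b k h) → B ∈ determinedOn (lfBox b k h) → ∀ ζ : Fin k → Bool,
      (νmix S).real (A ∩ B ∩ colCyl b k ζ) =
        (2 : ℝ) ^ k * (νmix S).real (A ∩ colCyl b k ζ) * (νmix S).real (B ∩ colCyl b k ζ)

/-- COLUMN GLUING (Cauchy–Schwarz junction across the anchor column, EVERY `S`): glue rows `j` (`rtArm_j`, `(0, b+j)`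
black, `lfArm_j`; horizontal adjacencies exist in every triangulation) give a left–right crossing of the wide box
`[-h, h] × [b, b+k)`, whence `glueFirstCol² ≤ ν(lrCross (-h) b (2h+1) k) · glueSecondCol`. Size M (given
`ColFactorisation`; transpose of `stub_rowGlue`).
  A statement to be proved (registered stub), not asserted here. -/
def ColGluing : Prop :=
  ∀ (S : Set ℤ) (b : ℤ) (k h : ℕ),
    glueFirstCol S b k h ^ 2 ≤ (νmix S).real (lrCross (-(h : ℤ)) b (2 * h + 1) k) * glueSecondCol S b k h

/-- CONTACT SECOND MOMENT ACROSS ROWS, UNIFORMLY IN THE PATTERN (OPEN): `E M² ≤ C (E M)²` for the row junction of the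
`n × (2n+1)` box, `C` uniform in `S` and `n` — the vertical clause of the crux for every `S`.
  A statement to be proved (registered stub), not asserted here. -/
def ContactSecondMomentRow : Prop :=
  ∃ C : ℝ, 0 < C ∧ ∀ (S : Set ℤ) (n : ℕ) (a : ℤ), 1 ≤ n →
    glueSecond S a n n ≤ C * glueFirst S a n n ^ 2 ∧ 0 < glueFirst S a n n

/-- CONTACT SECOND MOMENT ACROSS THE ANCHOR COLUMN, UNIFORMLY IN THE PATTERN (OPEN): the horizontal clause for every
`S` (the pattern is arbitrary, so cutting at the anchor column is no restriction: `mixed_of` recentres).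
  A statement to be proved (registered stub), not asserted here. -/
def ContactSecondMomentCol : Prop :=
  ∃ C : ℝ, 0 < C ∧ ∀ (S : Set ℤ) (n : ℕ) (b : ℤ), 1 ≤ n →
    glueSecondCol S b n n ≤ C * glueFirstCol S b n n ^ 2 ∧ 0 < glueFirstCol S b n n

/-! ## §4 Compositions (sorry-free) -/

/-- The isotropic instance of the uniform row inequality. -/
theorem contactSecondMoment_of_row (h : ContactSecondMomentRow) : ContactSecondMoment := by
  obtain ⟨C, hC, hb⟩ := h
  exact ⟨C, hC, fun n a hn => hb Set.univ n a hn⟩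

/-- The observable law evaluates LR crossing events as the gauge does: `(νmix S)(lrCross) = pLR`. -/
theorem nuMix_real_lrCross (S : Set ℤ) (a b : ℤ) (w h : ℕ) :
    (νmix S).real (lrCross a b w h) = pLR S a b w h := by
  have hmeas : MeasurableSet (lrCross a b w h) := by
    unfold lrCross
    exact measurable_blackEdges (measurableSet_openCrossing_of_countable _ _ _)
  rw [pLR, νmix, measureReal_def, measureReal_def, Measure.map_apply (measurable_obs S) hmeas]

/-- From a moment inequality `N² ≤ P·D` with `D ≤ C N²` and `0 < N`: `1/C ≤ P`. -/
theorem floor_of_moments {N D P C : ℝ} (hC : 0 < C) (hP : 0 ≤ P) (hglue : N ^ 2 ≤ P * D) (hD : D ≤ C * N ^ 2)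
    (hN : 0 < N) : 1 / C ≤ P := by
  have hN2 : 0 < N ^ 2 := by positivity
  have h1 : N ^ 2 ≤ P * (C * N ^ 2) := hglue.trans (mul_le_mul_of_nonneg_left hD hP)
  have h2 : 1 ≤ P * C := by
    by_contra h
    push Not at h
    nlinarith
  rw [div_le_iff₀ hC]
  linarith

/-- **`MixedBoxCrossingFree` — the crux for EVERY pattern — from the two junctions and the two uniform contact
inequalities** (no `sorry`): vertical clause across the row `b+n` (moved to the anchor row by `PatternLocality`),
horizontal clause across the middle column (moved to the anchor column by recentring the pattern), `Monotone'` to pass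
from `2n` to `2n+1`, and `GaugeBridge` to the free model. -/
theorem mixed_of (hB : GaugeBridge) (hL : PatternLocality) (hM : Monotone') (hRG : RowGluing) (hCG : ColGluing)
    (hR : ContactSecondMomentRow) (hC : ContactSecondMomentCol) : MixedBoxCrossingFree := by
  obtain ⟨Cr, hCr, hr⟩ := hR
  obtain ⟨Cc, hCc, hc⟩ := hC
  refine ⟨min (1 / Cr) (1 / Cc), lt_min (by positivity) (by positivity), fun S n a b hn => ⟨?_, ?_⟩⟩
  · -- horizontal clause: 2n × n box; recentre so that its middle column is the anchor column 0
    set S' : Set ℤ := {x | x + (a + n) ∈ S} with hS'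
    obtain ⟨hD, hN⟩ := hc S' n b hn
    have hfl := floor_of_moments hCc measureReal_nonneg (hCG S' b n n) hD hN
    rw [nuMix_real_lrCross] at hfl
    have hpat : ∀ i : ℕ, i < 2 * n → (a + i ∈ S ↔ -(n : ℤ) + i ∈ S') := fun i _ => by
      simp only [hS', Set.mem_setOf_eq]
      rw [show -(n : ℤ) + i + (a + n) = a + i by ring]
    rw [← (hB S n a b).1, ← pLR_two_mul_eq_pH, (hL S S' a (-(n : ℤ)) b b (2 * n) n hpat).1]
    have hmono : pLR S' (-(n : ℤ)) b (2 * n + 1) n ≤ pLR S' (-(n : ℤ)) b (2 * n) n :=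
      hM.1 S' (-(n : ℤ)) b (2 * n) (2 * n + 1) n (by omega) (by omega)
    exact (min_le_right _ _).trans (hfl.trans hmono)
  · -- vertical clause: n × 2n box; move the cut row to the anchor row 0
    obtain ⟨hD, hN⟩ := hr S n a hn
    have hfl := floor_of_moments hCr measureReal_nonneg (hRG S a n n) hD hN
    rw [nuMix_real_tbCross] at hfl
    rw [← (hB S n a b).2, ← pTB_two_mul_eq_pV]
    have hmono : pTB S a b n (2 * n + 1) ≤ pTB S a b n (2 * n) :=
      hM.2 S a b n (2 * n) (2 * n + 1) (by omega) (by omega)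
    have hmove : pTB S a b n (2 * n + 1) = pTB S a (-(n : ℤ)) n (2 * n + 1) :=
      (hL S S a a b (-(n : ℤ)) n (2 * n + 1) fun _ _ => Iff.rfl).2
    rw [hmove] at hmono
    exact (min_le_left _ _).trans (hfl.trans hmono)

/-! ## §5 Registered stubs (name-keyed aliases) and the registered composition -/

namespace Registered

/-- Alias keyed by the registered stub name. -/
abbrev stub_colFactorisation : Prop := ColFactorisation
/-- Alias keyed by the registered stub name. -/
abbrev stub_colGlue : Prop := ColFactorisation → ColGluing
/-- Alias keyed by the registered stub name (OPEN). -/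
abbrev stub_csmRow : Prop := ContactSecondMomentRow
/-- Alias keyed by the registered stub name (OPEN). -/
abbrev stub_csmCol : Prop := ContactSecondMomentCol

end Registered

/-- **The `∀ S` layer from the registered stubs** (registered composition): `MixedBoxCrossingFree` from the bridge, the
landed row junction (`stub_rowFactorisation`, `stub_rowGlue`), the column junction and the two uniform contact
inequalities; `PatternLocality`, `Monotone'` are the landed `stub_patternLocality`, `stub_monotone`. -/
theorem mixing_of_stubs :
    PatternLocality → Monotone' → GaugeBridge → Registered.stub_rowFactorisation → Registered.stub_rowGlue →
      Registered.stub_colFactorisation → Registered.stub_colGlue → Registered.stub_csmRow → Registered.stub_csmCol →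
      MixedBoxCrossingFree :=
  fun hL hM hB hRF hRG hCF hCG hR hC => mixed_of hB hL hM (hRG hRF) (hCG hCF) hR hC

end Summit.CriticalPhenomena.CardyFormulaZ2.Cruxes.IKMixedBoxCrossing.DefectClosureExploration

end
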